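import Summits.HodgeConjecture.HodgeConjecture.Theorems.Ring2AbelianAllAndreWeilFieldPencils
import Literature.AlgebraicGeometry.Deligne1982.WeilTypeCMQuadratic
import HarnessLib

/-!
# Ring 2 · AbelianAll — ANDRÉ AXIS, PART R-f: TWO COROLLARIES OF THE CM-FIELD ROW — (1) the Hodge conjecture for every DIVISOR–WEIL-GENERATED member
  from `B⋆` of the one total space, FACT-FREE (no endnote); (2) THE QUADRATIC COLUMN RECOVERED AND SHARPENED: for `E = ℚ(√−d)` the row of part R-b
  gives parts M-d/N §3 («`B⋆` ⟹ Weil-HC along the pencil») WITHOUT any Weil-type hypothesis and with the anchor «one rational global Weil class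
  algebraic at one member» in place of «a chart satisfying HC»

HONEST FRAMING (page 1, verbatim): **research route, not a corollary; conditional on HC_CM plus one named minimal statement.** Cell line:
research route conditional on HC_CM; not a corollary; Q11.4-sentence-2 already refuted in dim ≥ 3. Nothing in this file proves a case of the
Hodge conjecture or of `B(X)` for a named `X`: the rows are IMPLICATIONS with displayed hypotheses. `HC_CM`, `HC_AV`, the global nodes and every
named fact are ABSENT. Item `Theses.RankFourFaces.CMToAbelian` (stmt-16267) stays OPEN; N104 untouched; no node is born (0 `def`, 0 `sorry`).
Seat `pub-hodge-ring2-ab-andre-2`, gen 48 (part R: the André axis for CM fields). Inputs: part R-b §1 (the core row), the transport seat's slice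
theorem `Ring2Transport.hodgeConjectureFor_of_divisorWeilGenerated` (T6-F: for a member whose rational Hodge classes lie in the divisor–Weil span
`divisorWeilSpan`, HC follows from the algebraicity of its own rational Weil classes — Lefschetz (1,1) and cup products on abelian varieties, NO
endnote), and the lit seat's dictionary `Deligne1982.weilClassesField_X_sq_add_C_eq_weilClassesOf` (`weilClassesField A φ (T² + d) (2n) = weilClassesOf A φ n d`).

## Content (theorems only; standard axioms)

* §1 **`hodgeConjectureFor_member_of_lefschetzB_of_divisorWeilGenerated`** — FACT-FREE SUMMIT PREDICATE FOR MEMBERS: under part R-b §1's hypotheses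
  (compact abelian pencil with `B⋆(𝒳, η) ∀η`, global `E`-action with `P(φ_s) = 0`, a rational global `U` on `W_E(A_t) ⊗ ℂ` with `U|X_t ≠ 0`,
  `U|X_{s₀}` algebraic at one member), EVERY member `A_s` whose rational Hodge classes lie in the divisor–Weil span `divisorWeilSpan (A s) (φ s) P m`
  (the transport seat's inline binder «divisor–Weil generated»; in print the GENERAL member, Deligne–Milne endnote 16 — NOT used) satisfies
  `HodgeConjectureFor (A s).dim (A s).X`. Part R-b §4 needed the endnote `h24` to pass from `HasHodgeGroupSUCM` to this binder; here the binder
  is displayed and nothing is cited.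
* §2 **`weilClassesOf_le_algebraicClasses_forall_of_lefschetzB_of_rational_weilClass`** — THE QUADRATIC COLUMN (`P = T² + d`): compact pencil of
  abelian `2n`-folds with `B⋆(𝒳, η) ∀η`, a global `Φ` with `Φ`-compatible charts `(A_s, e_s, φ_s)`, `φ_s² = −d` (`d ≥ 1`), a RATIONAL global class
  `U ∈ H^{2n}(𝒳(ℂ); ℂ)` with `e_t^*(U|X_t)` in the Weil PLANE `W(A_t, φ_t) = weilClassesOf` and `U|X_t ≠ 0`, `U|X_{s₀}` algebraic at ONE member ⟹
  `W(A_s, φ_s) ⊆ Nⁿ(A_s)` for EVERY member. Compared with part N §3 (`weilClassesOf_le_algebraicClasses_forall_of_lefschetzB_of_hodgeConjectureFor_chart`):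
  NO `IsWeilType` hypothesis at any member, and the anchor is one algebraic class instead of a chart satisfying the Hodge conjecture; the flat
  class is a rational class of the plane (`E₊ ⊕ E₋`) rather than a class on the line `E₊`.

## Honest status

Corollaries (packaging of R-b with two tree dictionaries). §1's binder is per-member and is the honest residue of «the general member» on the
carriers (no Mumford–Tate groups in the tree); §2 does not change the strength of the W₆ instance (the input is still `B⋆` of the one 7-fold), it
removes hypotheses from its statement. Nothing minimal claimed; N104 untouched. EDGE LABELS: §1–§2 K (fact-free).
References: Deligne1982HodgeCycles (§4 (4.4); Milne 2003 re-edition endnote 16); vanGeemen1994HodgeAV (4.9, 4.11, 6.12); MoonenZarhin1998WeilClasses (§1);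
Markman2025SurveySecant (§4); Andre1996Motifs (§6.3 Remarque 2); Abdulali1994FamiliesAV (Thm. 5.5).
-/

noncomputable section

set_option linter.dupNamespace false

namespace Summit.HodgeConjecture.HodgeConjecture.Ring2.AbelianAll

open CategoryTheory CategoryTheory.Limits AlgebraicGeometry Polynomial
open Literature.AlgebraicGeometry Literature.AlgebraicGeometry.Motives
open Literature.AlgebraicGeometry.HodgeTheory Literature.AlgebraicGeometry.Deligne1982
open Literature.AlgebraicTopology.SingularHomology (singularCohomology)
open Summit.HodgeConjecture.HodgeConjecture.Ring2Transport (divisorWeilSpan hodgeConjectureFor_of_divisorWeilGenerated)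

variable {𝒳 S : SchemeOver ℂ} {f : 𝒳 ⟶ S} {d : ℕ}

/-! ## §1 The Hodge conjecture for every divisor–Weil-generated member, fact-free -/

section Members

/-- **`B⋆` OF THE ONE TOTAL SPACE ⟹ THE HODGE CONJECTURE FOR EVERY DIVISOR–WEIL-GENERATED MEMBER (fact-free).** Compact pencil of abelian `d`-folds
with `B⋆(𝒳, η) ∀η`, a global endomorphism `Φ` over `S`, charts `(A_s, e_s, φ_s)` with `P(φ_s) = 0` (`P` irreducible of degree `e`, `e · 2m = 2d`),
a rational global `U` on `W_E(A_t) ⊗ ℂ` with `U|X_t ≠ 0`, `U|X_{s₀}` algebraic at one member; then every member `A_s` whose rational Hodge classes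
lie in the divisor–Weil span (`Bᵏ ⊆ ⟨D, W_E⟩ᵏ ⊗ ℂ`, the transport seat's inline binder) satisfies `HodgeConjectureFor (A s).dim (A s).X`: its own
rational Weil classes are algebraic by part R-b §1, and the slice theorem T6-F does the rest (Lefschetz (1,1), cup products on abelian varieties).
No endnote, no `HC_CM`, no Verdier. [cite: vanGeemen1994HodgeAV, Thm. 4.11 and Thm. 6.12] [cite: Deligne1982HodgeCycles, §4 (4.4) and Milne 2003 re-edition endnote 16]
[cite: MoonenZarhin1998WeilClasses, §1] [cite: Abdulali1994FamiliesAV, Theorem 5.5 (p. 1130)] -/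
theorem hodgeConjectureFor_member_of_lefschetzB_of_divisorWeilGenerated
    (hf : IsCompactAbelianPencil f d) (hB : ∀ ηX : complexBetti 𝒳 2, StandardConjectureBStar (d + 1) 𝒳 ηX)
    (Φ : 𝒳 ⟶ 𝒳) (hΦ : Φ ≫ f = f)
    (A : ComplexPoints S → AbelianVariety ℂ) (e : ∀ s, (A s).X ≅ fiberOver f s) (φ : ∀ s, A s ⟶ A s)
    (hK : ∀ s, ∃ Φs : fiberOver f s ⟶ fiberOver f s, Φs ≫ fiberι f s = fiberι f s ≫ Φ ∧ (e s).hom ≫ Φs = (φ s).hom.hom.hom ≫ (e s).hom)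
    {P : Polynomial ℤ} {eP m : ℕ} (hPe : P.natDegree = eP) (hPirr : Irreducible (P.map (Int.castRingHom ℚ)))
    (hP : ∀ s, Polynomial.eval₂ (Int.castRingHom (CategoryTheory.End (A s))) ((φ s : CategoryTheory.End (A s))) P = 0)
    (her : eP * (2 * m) = 2 * d) (hm : 0 < m)
    (U : complexBetti 𝒳 (2 * m)) (hUQ : IsRationalClass U) {t : ComplexPoints S}
    (hUt : complexBetti.map (e t).hom (2 * m) (complexBetti.map (fiberι f t) (2 * m) U) ∈ weilClassesField (A t) (φ t) P (2 * m))
    (hU0 : complexBetti.map (fiberι f t) (2 * m) U ≠ 0)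
    {s₀ : ComplexPoints S} (hU₀ : complexBetti.map (fiberι f s₀) (2 * m) U ∈ algebraicClasses (fiberOver f s₀) m)
    {s : ComplexPoints S}
    (hgen : ∀ (k : ℕ) (c : complexBetti (A s).X (2 * k)), IsRationalClass c →
      IsOfHodgeType (A s).dim (A s).X (2 * k) k k c → c ∈ divisorWeilSpan (A s) (φ s) P m k) :
    HodgeConjectureFor (A s).dim (A s).X :=
  hodgeConjectureFor_of_divisorWeilGenerated hgen fun _ hw _ _ ↦
    weilClassesField_le_algebraicClasses_forall_of_lefschetzB_of_mem_algebraicClasses hf hB Φ hΦ A e φ hK hPe hPirr hP her hm U hUQ hUt hU0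
      hU₀ s hw

end Members

/-! ## §2 The quadratic column, recovered without the Weil-type hypothesis -/

section Quadratic

/-- **THE QUADRATIC ROW FROM PART R (fact-free): no Weil-type hypothesis, anchor = one algebraic class.** Compact pencil `f : 𝒳 ⟶ S` of abelian
`2n`-folds (`n ≥ 1`) with `B⋆(𝒳, η)` for every `η`, a global endomorphism `Φ` over `S`, `Φ`-compatible charts `(A_s, e_s, φ_s)` with `φ_s² = −d`
(`d ≥ 1`), and a RATIONAL global class `U ∈ H^{2n}(𝒳(ℂ); ℂ)` whose charted restriction at `t` lies in the Weil plane `W(A_t, φ_t) = weilClassesOf`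
with `U|X_t ≠ 0`; if `U|X_{s₀}` is algebraic at ONE member then `W(A_s, φ_s) ⊆ Nⁿ(A_s)` for EVERY member `s`. Part R-b §1 for `P = T² + d`
(irreducible over `ℚ` for `d ≥ 1`; `weilClassesField A φ (T² + d) (2n) = weilClassesOf A φ n d`). [cite: vanGeemen1994HodgeAV, 4.9–4.11]
[cite: MoonenZarhin1998WeilClasses, §1 (dim_F W_F = 1)] [cite: Markman2025SurveySecant, §4 (pp. 9–10)] [cite: Andre1996Motifs, §6.3 Remarque 2 (p. 33)] -/
theorem weilClassesOf_le_algebraicClasses_forall_of_lefschetzB_of_rational_weilClass {n : ℕ} (hn : 0 < n) (hd : 0 < d)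
    (hf : IsCompactAbelianPencil f (2 * n)) (hB : ∀ ηX : complexBetti 𝒳 2, StandardConjectureBStar (2 * n + 1) 𝒳 ηX)
    (Φ : 𝒳 ⟶ 𝒳) (hΦ : Φ ≫ f = f)
    (A : ComplexPoints S → AbelianVariety ℂ) (e : ∀ s, (A s).X ≅ fiberOver f s) (φ : ∀ s, A s ⟶ A s)
    (hφ : ∀ s, φ s ≫ φ s = -(d • 𝟙 (A s)))
    (hK : ∀ s, ∃ Φs : fiberOver f s ⟶ fiberOver f s, Φs ≫ fiberι f s = fiberι f s ≫ Φ ∧ (e s).hom ≫ Φs = (φ s).hom.hom.hom ≫ (e s).hom)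
    (U : complexBetti 𝒳 (2 * n)) (hUQ : IsRationalClass U) {t : ComplexPoints S}
    (hUt : complexBetti.map (e t).hom (2 * n) (complexBetti.map (fiberι f t) (2 * n) U) ∈ weilClassesOf (A t) (φ t) n d)
    (hU0 : complexBetti.map (fiberι f t) (2 * n) U ≠ 0)
    {s₀ : ComplexPoints S} (hU₀ : complexBetti.map (fiberι f s₀) (2 * n) U ∈ algebraicClasses (fiberOver f s₀) n)
    (s : ComplexPoints S) :
    weilClassesOf (A s) (φ s) n d ≤ algebraicClasses (A s).X n := by
  have hirr : Irreducible ((X ^ 2 + C (d : ℤ) : Polynomial ℤ).map (Int.castRingHom ℚ)) := by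
    rw [Polynomial.map_add, Polynomial.map_pow, Polynomial.map_X, Polynomial.map_C, eq_intCast, Int.cast_natCast]
    exact irreducible_X_sq_add_C_rat hd
  have hdeg : (X ^ 2 + C (d : ℤ) : Polynomial ℤ).natDegree = 2 := Polynomial.natDegree_X_pow_add_C
  have hP : ∀ s, Polynomial.eval₂ (Int.castRingHom (CategoryTheory.End (A s))) ((φ s : CategoryTheory.End (A s)))
      (X ^ 2 + C (d : ℤ)) = 0 := fun s ↦ (eval₂_X_sq_add_C_End_eq_zero_iff (φ s) d).2 (hφ s)
  rw [← weilClassesField_X_sq_add_C_eq_weilClassesOf]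
  rw [← weilClassesField_X_sq_add_C_eq_weilClassesOf] at hUt
  exact weilClassesField_le_algebraicClasses_forall_of_lefschetzB_of_mem_algebraicClasses hf hB Φ hΦ A e φ hK hdeg hirr hP (by ring) hn U hUQ
    hUt hU0 hU₀ s

end Quadratic

end Summit.HodgeConjecture.HodgeConjecture.Ring2.AbelianAll

end
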